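import Summits.QuantumFields.BalabanUV.Beta.GAN24.StripRegularBiLoc
import Literature.MathematicalPhysics.QuantumFieldTheory.Balaban1983to89.B4Green242Bridge

/-!
# G-an2-4 ∕ (CONV-C), S-slot node (S3-3), part 3: CALCULUS of the two-momentum lattice kernel `latticeKernel₂` —
# linearity, phase factors translate each leg, products of one-momentum kernels are two-momentum kernels

Self-row «S3-3-ENGINE*» of the G-an2-4 formalisation swarm (unit `b2b-balaban-gan24-formalise-leaf-14`, gen 15), supplement to
`GAN24/StripRegularRestrict` (part 1, symbol side) and `GAN24/StripRegularBiLoc` (part 2, kernel side: decay, `BiLoc`, Fubini): the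
rewriting rules a two-momentum fibre readout (node S3-L1 of the row owner's `SKELETON-S3.md`: «two-momentum Bloch form of a sandwich»,
`B4TorusKernel`∕`FibreDFT` twice) manipulates `latticeKernel₂` with — the two-leg versions of pv17∕B4Green244's one-momentum
`latticeKernel_phase_mul ∕ _congr ∕ _sum_mul` and B4Green242Bridge's `latticeKernel_sub ∕ _const_mul`, obtained on the joint space
`Fin (d+1+d+1)` through `pair ∕ joint`.  HONEST FRAMING (cell rule, verbatim): «discharging `BetaPertH` makes Bałaban's UV stability
UNCONDITIONAL — a real constructive-QFT result; it is NOT the continuum limit and NOT the Clay problem.»  HONEST DEPENDENCY (verbatim):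
«continuum YM on T⁴ ⇐ BetaPertH ∧ nine spine estimates (0/9 proved); BetaPertH ⇐ (D1) ∧ (D4) ∧ CAP+tail; G-an2-4 gates asym, D1 and
NE2/3/4.»  NOT IN PRINT; OUR BOOKKEEPING ([folklore]); mentions NO object of an2's typed U = 1 system, cites nothing, mints no `Prop`,
DISCHARGES NOTHING of (hS, hSall) or «E3Shape».  NOT BetaPertH, NOT continuum, NOT Clay.

## What is proved ([folklore], `0 sorry`)
* `pair_add ∕ pair_neg ∕ pair_zero`, `phaseC_pair` (`(p,q)·(s,t) = p·s + q·t` at complex momenta), `integrableOn_integrand_joint`;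
* `latticeKernel₂_congr` (symbols agreeing on the real `BZ × BZ`), `latticeKernel₂_const_mul`, `latticeKernel₂_sub`, `latticeKernel₂_sum_mul`
  (finite superpositions of jointly strip-regular symbols);
* PHASES TRANSLATE: `latticeKernel₂_phase_left` (`e^{ip·s}·G ↦ K(x+s, y)`), `latticeKernel₂_phase_right` (`e^{iq·t}·G ↦ K(x, y+t)`) — the
  re-centring `x ↦ x′ − u′`, `z ↦ z′ − u′` of a stencil's readout;
* **`latticeKernel_mul_latticeKernel`**: for strip-regular one-momentum symbols `a`, `b`,
  `latticeKernel a x · latticeKernel b y = latticeKernel₂ (fun p q ↦ a p · b q) x y` (part 2's Fubini `latticeKernel₂_eq_iterated` + the lifts).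
-/

noncomputable section

open Complex Set MeasureTheory
open Literature.MathematicalPhysics.QuantumFieldTheory.Balaban1983to89
open Literature.MathematicalPhysics.QuantumFieldTheory.Balaban1983to89.Beta
open B4Strip (ofRealVec Strip)
open B4ContourShift (BZ latticeKernel fourierBox integrand phase StripRegular)
open B4Green244 (phaseC latticeKernel_phase_mul latticeKernel_congr latticeKernel_sum_mul)
open B4Green242Bridge (latticeKernel_sub latticeKernel_const_mul)
open Summit.QuantumFields.BalabanUV.Beta.GAN24.StripRegularRestrict
open Summit.QuantumFields.BalabanUV.Beta.GAN24.StripRegularBiLoc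

namespace Summit.QuantumFields.BalabanUV.Beta.GAN24.StripRegularBiLocAlgebra

/-! ## §5 Calculus of the two-momentum kernel: linearity, phases translate, products of one-momentum kernels -/

section Algebra

variable {d : ℕ}

/-- [folklore] `pair` is additive. -/
theorem pair_add {β : Type*} [Add β] (x y x' y' : Fin (d + 1) → β) :
    pair (x + x') (y + y') = pair x y + pair x' y' := by
  funext l
  rcases inl2_or_inr2 l with ⟨i, rfl⟩ | ⟨i, rfl⟩
  · simp only [Pi.add_apply, pair_inl]
  · simp only [Pi.add_apply, pair_inr]

/-- [folklore] `pair` commutes with negation. -/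
theorem pair_neg {β : Type*} [Neg β] (x y : Fin (d + 1) → β) : pair (-x) (-y) = -pair x y := by
  funext l
  rcases inl2_or_inr2 l with ⟨i, rfl⟩ | ⟨i, rfl⟩
  · simp only [Pi.neg_apply, pair_inl]
  · simp only [Pi.neg_apply, pair_inr]

/-- [folklore] `pair 0 0 = 0`. -/
theorem pair_zero {β : Type*} [Zero β] : pair (0 : Fin (d + 1) → β) 0 = 0 := by
  funext l
  rcases inl2_or_inr2 l with ⟨i, rfl⟩ | ⟨i, rfl⟩
  · simp only [Pi.zero_apply, pair_inl]
  · simp only [Pi.zero_apply, pair_inr]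

/-- [folklore] The complex phase of a joint momentum against a joint lattice vector splits. -/
theorem phaseC_pair (P : Fin (d + 1 + d + 1) → ℂ) (s t : Fin (d + 1) → ℤ) :
    phaseC P (pair s t) = phaseC (fstC P) s + phaseC (sndC P) t := by
  simp only [phaseC]
  rw [sum_pair_index]
  simp only [pair_inl, pair_inr, fstC_apply, sndC_apply]

/-- [folklore] The joint integrand is integrable on the joint zone for a jointly strip-regular symbol. -/
theorem integrableOn_integrand_joint {G : (Fin (d + 1) → ℂ) → (Fin (d + 1) → ℂ) → ℂ} {κ M : ℝ}
    (h : StripRegular (joint G) κ M) (hκ : 0 ≤ κ) (x y : Fin (d + 1) → ℤ) :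
    IntegrableOn (integrand (joint G) (pair x y)) (BZ (d + 1 + d + 1)) :=
  h.integrableOn hκ (pair x y)

/-- [folklore] Symbols agreeing on the real joint zone have the same two-momentum kernel. -/
theorem latticeKernel₂_congr {G₁ G₂ : (Fin (d + 1) → ℂ) → (Fin (d + 1) → ℂ) → ℂ}
    (h : ∀ p ∈ BZ (d + 1), ∀ q ∈ BZ (d + 1), G₁ (ofRealVec p) (ofRealVec q) = G₂ (ofRealVec p) (ofRealVec q))
    (x y : Fin (d + 1) → ℤ) : latticeKernel₂ G₁ x y = latticeKernel₂ G₂ x y := by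
  unfold latticeKernel₂
  refine latticeKernel_congr (fun P hP => ?_) (pair x y)
  obtain ⟨p, q, rfl⟩ : ∃ p q : Fin (d + 1) → ℝ, P = pair p q :=
    ⟨fun i => P (inl2 i), fun i => P (inr2 i), by
      funext l; rcases inl2_or_inr2 l with ⟨i, rfl⟩ | ⟨i, rfl⟩ <;> simp⟩
  rw [pair_mem_BZ_iff] at hP
  rw [ofRealVec_pair, joint_pair, joint_pair]
  exact h p hP.1 q hP.2

/-- [folklore] Linearity: constant multiples. -/
theorem latticeKernel₂_const_mul (c : ℂ) (G : (Fin (d + 1) → ℂ) → (Fin (d + 1) → ℂ) → ℂ) (x y : Fin (d + 1) → ℤ) :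
    latticeKernel₂ (fun p q => c * G p q) x y = c * latticeKernel₂ G x y := by
  unfold latticeKernel₂
  exact latticeKernel_const_mul c (joint G) (pair x y)

/-- [folklore] Linearity: differences (jointly strip-regular symbols). -/
theorem latticeKernel₂_sub {G₁ G₂ : (Fin (d + 1) → ℂ) → (Fin (d + 1) → ℂ) → ℂ} {κ M₁ M₂ : ℝ}
    (h₁ : StripRegular (joint G₁) κ M₁) (h₂ : StripRegular (joint G₂) κ M₂) (hκ : 0 ≤ κ) (x y : Fin (d + 1) → ℤ) :
    latticeKernel₂ (fun p q => G₁ p q - G₂ p q) x y = latticeKernel₂ G₁ x y - latticeKernel₂ G₂ x y := by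
  unfold latticeKernel₂
  exact latticeKernel_sub (pair x y) (h₁.integrableOn hκ _) (h₂.integrableOn hκ _)

/-- [folklore] Linearity: finite superpositions `Σ_i c_i G_i` of jointly strip-regular symbols. -/
theorem latticeKernel₂_sum_mul {ι : Type*} (s : Finset ι) (c : ι → ℂ) (G : ι → (Fin (d + 1) → ℂ) → (Fin (d + 1) → ℂ) → ℂ)
    {κ : ℝ} {M : ι → ℝ} (h : ∀ i ∈ s, StripRegular (joint (G i)) κ (M i)) (hκ : 0 ≤ κ) (x y : Fin (d + 1) → ℤ) :
    latticeKernel₂ (fun p q => ∑ i ∈ s, c i * G i p q) x y = ∑ i ∈ s, c i * latticeKernel₂ (G i) x y := by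
  unfold latticeKernel₂
  exact latticeKernel_sum_mul s c (fun i => joint (G i)) (pair x y) fun i hi => (h i hi).integrableOn hκ _

/-- [folklore] PHASES TRANSLATE, first leg: a factor `e^{i p·s}` translates the kernel by `s` in `x`. -/
theorem latticeKernel₂_phase_left (G : (Fin (d + 1) → ℂ) → (Fin (d + 1) → ℂ) → ℂ) (x y s : Fin (d + 1) → ℤ) :
    latticeKernel₂ (fun p q => cexp (I * phaseC p s) * G p q) x y = latticeKernel₂ G (x + s) y := by
  unfold latticeKernel₂
  have h := latticeKernel_phase_mul (joint G) (pair x y) (pair s 0)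
  rw [← pair_add, add_zero] at h
  rw [← h]
  congr 1
  funext P
  simp only [joint_apply, phaseC_pair]
  simp [phaseC]

/-- [folklore] PHASES TRANSLATE, second leg: a factor `e^{i q·t}` translates the kernel by `t` in `y`. -/
theorem latticeKernel₂_phase_right (G : (Fin (d + 1) → ℂ) → (Fin (d + 1) → ℂ) → ℂ) (x y t : Fin (d + 1) → ℤ) :
    latticeKernel₂ (fun p q => cexp (I * phaseC q t) * G p q) x y = latticeKernel₂ G x (y + t) := by
  unfold latticeKernel₂
  have h := latticeKernel_phase_mul (joint G) (pair x y) (pair 0 t)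
  rw [← pair_add, add_zero] at h
  rw [← h]
  congr 1
  funext P
  simp only [joint_apply, phaseC_pair]
  simp [phaseC]

/-- [folklore] **PRODUCTS OF ONE-MOMENTUM KERNELS ARE TWO-MOMENTUM KERNELS**: for strip-regular `a`, `b`,
`latticeKernel a x · latticeKernel b y = latticeKernel₂ (fun p q ↦ a p · b q) x y` (Fubini + the two lifts). -/
theorem latticeKernel_mul_latticeKernel {a b : (Fin (d + 1) → ℂ) → ℂ} {κ Ma Mb : ℝ} (ha : StripRegular a κ Ma)
    (hb : StripRegular b κ Mb) (hκ : 0 ≤ κ) (x y : Fin (d + 1) → ℤ) :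
    latticeKernel a x * latticeKernel b y = latticeKernel₂ (fun p q => a p * b q) x y := by
  have hj : StripRegular (joint fun p q => a p * b q) κ (Ma * Mb) :=
    (stripRegular_compFst ha).mul (stripRegular_compSnd hb) (stripRegular_bound_nonneg ha hκ)
  rw [latticeKernel₂_eq_iterated hj hκ]
  have h1 : (fun p => latticeKernel (fun q => a p * b q) y) = fun p => latticeKernel b y * a p := by
    funext p
    rw [latticeKernel_const_mul, mul_comm]
  rw [h1, latticeKernel_const_mul, mul_comm]

end Algebra

end Summit.QuantumFields.BalabanUV.Beta.GAN24.StripRegularBiLocAlgebra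

end
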